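import Summits.CriticalPhenomena.PercolationContinuityZ3.Theorems.PercNearOneGluingNoHeavyLowerTailSahiQuantitativeHarris
import HarnessLib

/-!
# Quantitative Harris, the SYMMETRIC sharp constant: `(Σ_{t<|s|} θ^t)·Σ_{e∈s} J_e(f,g) ≤ |s|·Cov(f,g)` whenever `θ ≤ min(q_e, 1−q_e)`

Support file (`--supports stmt-CriticalPhenomena-4575`), prover seat `prim-rate-mine-2` (lane prim-rate, constants-miner (c), BENCH row M2-R1,
REF-SIGNED).  No definitions, no named facts, no sorries; standard axioms.  Companion of `…SahiQuantitativeHarris.lean` (ordered peeling).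

`QuantHarris.peelSum_le_cov` gives, along ONE order of the coordinates, the coefficients `Π_{s<t} min(q_{j_s},1−q_{j_s})`; its symmetric
consequence `Σ_j J_j ≤ |ι|·Cov` (`sum_coinfluence_le_card_mul_cov`) keeps only the leading `1`.  THIS FILE proves the symmetric bound with the
full geometric factor: if `θ ≤ min(q_e, 1−q_e)` for every coordinate, then for every finite set `s` of coordinates and nonnegative monotone `f, g`

  `(Σ_{t<|s|} θ^t) · Σ_{e∈s} J_e(f,g) ≤ |s| · (E(fg) − E f·E g)`      (`QuantHarris.geomSum_mul_sum_coinfluence_le`),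

i.e. `Cov(f,g) ≥ c(θ,m)·Σ_e J_e` with `c(θ,m) = (1 + θ + … + θ^{m−1})/m` (`= (1−θ^m)/(m(1−θ))`; `(2/m)(1−2^{−m})` at `q ≡ ½`).  This constant is
SHARP: for `q_e ≡ q ≤ ½` (`θ = q`) equality holds at `f = g = Π_e x_e` (lane census / PROOFS.md P1: `Cov = q^m(1−q^m)`,
`Σ_e J_e = m(1−q)q^m`).  Proof: an exchangeable induction on `|s|` — for each `e ∈ s`, `Cov = J_e + Cov(E_e f, E_e g)`
(`cov_eq_coinfluence_add_cov_condAvg`), the induction hypothesis for `s∖e` applied to `(E_e f, E_e g)`, and `J_{e'}(E_e f, E_e g) ≥ θ·J_{e'}(f,g)`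
(`min_mul_coinfluence_le_coinfluence_condAvg`); summing over `e ∈ s` gives `|s|(|s|−1)·Cov ≥ (|s|−1)(1 + θ·Σ_{t<|s|−1}θ^t)·Σ_e J_e`.
[cite: Harris1960, Lemma 4.1 (p. 16)] [cite: FortuinKasteleynGinibre1971, Prop. 1 (p. 91)]
-/

namespace Summit.CriticalPhenomena.PercolationContinuityZ3.Theorems

namespace QuantHarris

open Finset Literature.Combinatorics.Sahi2008 SahiSubsetChord SahiCoSingleton

variable {ι : Type*} [Fintype ι] [DecidableEq ι]

/-- **Symmetric quantitative Harris with the geometric factor.**  If `0 ≤ θ ≤ min(q_e, 1−q_e)` for all `e`, then for every finite set `s` of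
coordinates and nonnegative monotone `f, g`:  `(Σ_{t<|s|} θ^t)·Σ_{e∈s} J_e(f,g) ≤ |s|·(E(fg) − E f·E g)`. [this file] -/
theorem geomSum_mul_sum_coinfluence_le {q : ι → ℝ} (hq : ∀ i, 0 ≤ q i ∧ q i ≤ 1) {θ : ℝ} (hθ0 : 0 ≤ θ)
    (hθ : ∀ i, θ ≤ min (q i) (1 - q i)) :
    ∀ (s : Finset ι) (f g : (ι → Bool) → ℝ), (∀ x, 0 ≤ f x) → (∀ x, 0 ≤ g x) → Monotone f → Monotone g →
      (∑ t ∈ range s.card, θ ^ t) * ∑ e ∈ s, coinfluence q e f g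
        ≤ (s.card : ℝ) * (ex (prodWeight q) (f * g) - ex (prodWeight q) f * ex (prodWeight q) g) := by
  -- strong induction on `|s|`
  have main : ∀ (N : ℕ) (s : Finset ι), s.card = N → ∀ (f g : (ι → Bool) → ℝ), (∀ x, 0 ≤ f x) → (∀ x, 0 ≤ g x) →
      Monotone f → Monotone g →
      (∑ t ∈ range s.card, θ ^ t) * ∑ e ∈ s, coinfluence q e f g
        ≤ (s.card : ℝ) * (ex (prodWeight q) (f * g) - ex (prodWeight q) f * ex (prodWeight q) g) := by
    intro N
    induction N with
    | zero =>
      intro s hs f g _ _ _ _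
      rw [Finset.card_eq_zero.1 hs]
      simp
    | succ N ih =>
      intro s hs f g hf0 hg0 hf hg
      set C : ℝ := ex (prodWeight q) (f * g) - ex (prodWeight q) f * ex (prodWeight q) g with hC
      -- for each `e ∈ s`: `N·C ≥ N·J_e + θ·(Σ_{t<N} θ^t)·Σ_{e'∈s∖e} J_{e'}`
      have hstep : ∀ e ∈ s, (N : ℝ) * coinfluence q e f g + θ * (∑ t ∈ range N, θ ^ t) * ∑ e' ∈ s.erase e, coinfluence q e' f g
          ≤ (N : ℝ) * C := by
        intro e he
        have hcard : (s.erase e).card = N := by rw [Finset.card_erase_of_mem he, hs]; rfl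
        -- the identity `C = J_e + Cov(E_e f, E_e g)`
        have hid := cov_eq_coinfluence_add_cov_condAvg q e f g
        -- IH for `s.erase e` with the averaged functions
        have hIH := ih (s.erase e) hcard (condAvg q e f) (condAvg q e g) (condAvg_nonneg hq hf0 e) (condAvg_nonneg hq hg0 e)
          (condAvg_mono hq hf e) (condAvg_mono hq hg e)
        rw [hcard] at hIH
        -- Step 2 termwise on `s.erase e`
        have hterm : ∀ e' ∈ s.erase e, θ * coinfluence q e' f g ≤ coinfluence q e' (condAvg q e f) (condAvg q e g) := by
          intro e' he'
          have hne : e' ≠ e := Finset.ne_of_mem_erase he'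
          have h1 := min_mul_coinfluence_le_coinfluence_condAvg hq hne hf hg
          have hJ0 : 0 ≤ coinfluence q e' f g := by
            unfold coinfluence
            refine mul_nonneg (mul_nonneg (hq e').1 (by linarith [(hq e').2])) ?_
            exact ex_nonneg (SahiSubsetChord.prodWeight_nonneg hq) fun x => mul_nonneg (pivDiff_nonneg hf e' x) (pivDiff_nonneg hg e' x)
          exact le_trans (mul_le_mul_of_nonneg_right (hθ e) hJ0) h1
        have hsum : θ * ∑ e' ∈ s.erase e, coinfluence q e' f g ≤ ∑ e' ∈ s.erase e, coinfluence q e' (condAvg q e f) (condAvg q e g) := by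
          rw [Finset.mul_sum]; exact Finset.sum_le_sum hterm
        have hgeom0 : 0 ≤ ∑ t ∈ range N, θ ^ t := Finset.sum_nonneg fun t _ => pow_nonneg hθ0 t
        have h2 : θ * (∑ t ∈ range N, θ ^ t) * ∑ e' ∈ s.erase e, coinfluence q e' f g
            ≤ (∑ t ∈ range N, θ ^ t) * ∑ e' ∈ s.erase e, coinfluence q e' (condAvg q e f) (condAvg q e g) := by
          calc θ * (∑ t ∈ range N, θ ^ t) * ∑ e' ∈ s.erase e, coinfluence q e' f g
              = (∑ t ∈ range N, θ ^ t) * (θ * ∑ e' ∈ s.erase e, coinfluence q e' f g) := by ring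
            _ ≤ (∑ t ∈ range N, θ ^ t) * ∑ e' ∈ s.erase e, coinfluence q e' (condAvg q e f) (condAvg q e g) :=
                mul_le_mul_of_nonneg_left hsum hgeom0
        rw [hC, hid]
        nlinarith [hIH, h2]
      -- sum `hstep` over `e ∈ s`
      have hsumstep := Finset.sum_le_sum hstep
      rw [Finset.sum_const, nsmul_eq_mul, hs] at hsumstep
      -- Σ_e Σ_{e'∈s∖e} J_{e'} = N · Σ_e J_e   (each `e'` is missed exactly once)
      have hdouble : ∑ e ∈ s, ∑ e' ∈ s.erase e, coinfluence q e' f g = (N : ℝ) * ∑ e ∈ s, coinfluence q e f g := by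
        have : ∀ e ∈ s, ∑ e' ∈ s.erase e, coinfluence q e' f g = (∑ e' ∈ s, coinfluence q e' f g) - coinfluence q e f g := by
          intro e he
          rw [← Finset.add_sum_erase s _ he]; ring
        rw [Finset.sum_congr rfl this, Finset.sum_sub_distrib, Finset.sum_const, nsmul_eq_mul, hs]
        push_cast
        ring
      rw [Finset.sum_add_distrib, ← Finset.mul_sum, ← Finset.mul_sum, hdouble] at hsumstep
      -- the geometric identity `Σ_{t<N+1} θ^t = 1 + θ·Σ_{t<N} θ^t`
      have hgeom : ∑ t ∈ range (N + 1), θ ^ t = 1 + θ * ∑ t ∈ range N, θ ^ t := by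
        rw [Finset.sum_range_succ', pow_zero, Finset.mul_sum]
        simp only [pow_succ]
        ring
      rw [hs, hgeom]
      push_cast
      -- from `N·ΣJ + θ S_N · N·ΣJ ≤ (N+1)·N·C` conclude `(1 + θ S_N)·ΣJ ≤ (N+1)·C`
      rcases Nat.eq_zero_or_pos N with hN0 | hNpos
      · -- `|s| = 1`: the one-coordinate bound
        subst hN0
        obtain ⟨e, rfl⟩ := Finset.card_eq_one.1 hs
        simp only [Finset.sum_singleton, range_zero, Finset.sum_empty, mul_zero, add_zero, one_mul, Nat.cast_zero, zero_add]
        have h := peelSum_le_cov hq [e] (List.nodup_singleton e) f g hf0 hg0 hf hg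
        simpa using h
      · have hNr : (0 : ℝ) < N := by exact_mod_cast hNpos
        push_cast at hsumstep
        have key : (N : ℝ) * ((1 + θ * ∑ t ∈ range N, θ ^ t) * ∑ e ∈ s, coinfluence q e f g) ≤ (N : ℝ) * (((N : ℝ) + 1) * C) := by
          have e1 : (N : ℝ) * ((1 + θ * ∑ t ∈ range N, θ ^ t) * ∑ e ∈ s, coinfluence q e f g)
              = (N : ℝ) * ∑ e ∈ s, coinfluence q e f g + θ * (∑ t ∈ range N, θ ^ t) * ((N : ℝ) * ∑ e ∈ s, coinfluence q e f g) := by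
            ring
          have e2 : (N : ℝ) * (((N : ℝ) + 1) * C) = ((N : ℝ) + 1) * ((N : ℝ) * C) := by ring
          rw [e1, e2]
          exact hsumstep
        exact le_of_mul_le_mul_left key hNr
  intro s f g hf0 hg0 hf hg
  exact main s.card s rfl f g hf0 hg0 hf hg

/-- **The sharp symmetric constant on the whole cube**: if `θ ≤ min(q_e, 1−q_e)` for all `e`, then
`(Σ_{t<|ι|} θ^t)·Σ_e J_e(f,g) ≤ |ι|·Cov(f,g)`, i.e. `Cov ≥ ((1 + θ + ⋯ + θ^{m−1})/m)·Σ_e q_e(1−q_e)E[Δ_e fΔ_e g]` — attained by the AND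
of all coordinates when `q ≡ θ ≤ ½`. [this file] -/
theorem geomSum_mul_sum_coinfluence_le_card_mul_cov {q : ι → ℝ} (hq : ∀ i, 0 ≤ q i ∧ q i ≤ 1) {θ : ℝ} (hθ0 : 0 ≤ θ)
    (hθ : ∀ i, θ ≤ min (q i) (1 - q i)) (f g : (ι → Bool) → ℝ) (hf0 : ∀ x, 0 ≤ f x) (hg0 : ∀ x, 0 ≤ g x)
    (hf : Monotone f) (hg : Monotone g) :
    (∑ t ∈ range (Fintype.card ι), θ ^ t) * ∑ e, coinfluence q e f g
      ≤ (Fintype.card ι : ℝ) * (ex (prodWeight q) (f * g) - ex (prodWeight q) f * ex (prodWeight q) g) := by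
  have h := geomSum_mul_sum_coinfluence_le hq hθ0 hθ Finset.univ f g hf0 hg0 hf hg
  rwa [Finset.card_univ] at h

end QuantHarris

end Summit.CriticalPhenomena.PercolationContinuityZ3.Theorems
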